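import Mathlib.Analysis.Normed.Module.MultipliableUniformlyOn
import Mathlib.Analysis.Complex.LocallyUniformLimit
import Mathlib.Analysis.SpecialFunctions.Pow.Deriv
import Literature.NumberTheory.LFunctions.TwistedRankinSelbergEulerValue
import HarnessLib

/-!
# Twisted Rankin–Selberg Euler products: holomorphy on the half-plane of absolute convergence

Topic `Literature/NumberTheory/LFunctions` (namespace `Literature.NumberTheory.LFunctions`).
Sibling proof file of `Literature.NumberTheory.LFunctions.TwistedRankinSelbergEulerValue`
(definition request `twistedRankinSelbergEulerValue` of route `MaassFreeConverse`): theorems only,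
no definition, no named fact.

* `differentiableOn_satakeTwistFactor`: the twisted local factor
  `s ↦ ∏_{y ∈ M} (1 - y u q^{-s})⁻¹` is holomorphic on `{re s > c}` when `‖y‖ < q^c` (`‖u‖ ≤ 1`).
* `EulerAbsConvergent.differentiableOn_twistedSatakeEulerValue`: if the Euler product of the
  Satake family `L` converges absolutely (`EulerAbsConvergent L s`) at every `s` with `re s > c`,
  then its value `s ↦ twistedSatakeEulerValue L χ s` is HOLOMORPHIC on `{re s > c}` — the product
  of holomorphic factors converges locally uniformly there (Mathlib
  `Summable.hasProdLocallyUniformlyOn_one_add`, fed the uniform bound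
  `‖factor - 1‖ ≤ 4 ∑_{y ∈ L v} ‖y‖ q_v^{-c'}` on `{re s > c'}`, `c' > c`), and locally uniform
  limits of holomorphic functions are holomorphic (`TendstoLocallyUniformlyOn.differentiableOn`,
  Weierstrass; Ahlfors, *Complex Analysis*, Ch. 5 §1.1 Thm. 1 and §2.2).
* `EulerAbsConvergent.isTwistedEulerContinuation`: hence the Euler product on `{re s > c}` is a
  continuation in the sense of `IsTwistedEulerContinuation`, and
* `EulerAbsConvergent.twistedSatakeContinuedValue_eq`,
  `EulerAbsConvergent.twistedRankinSelbergContinuedValue_eq`: the CONTINUED VALUE AGREES WITH THE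
  VALUE of the Euler product at every point of an open half-plane of absolute convergence (the
  consistency of the two notions of the definition file; Iwaniec–Kowalski, *Analytic Number
  Theory*, §5.1; Jacquet–Shalika (1981), §2 for the automorphic case `re s > 1`).

## References

* L. V. Ahlfors, *Complex Analysis*, 3rd ed. (1979), Ch. 5 §1.1 (Weierstrass's theorem), §2.2
  (infinite products) [AhlforsCA1979].
* H. Iwaniec, E. Kowalski, *Analytic Number Theory*, AMS Colloq. Publ. 53 (2004), §5.1
  [IwaniecKowalski2004].
* H. Jacquet, J. A. Shalika, *On Euler products and the classification of automorphic
  representations I*, Amer. J. Math. 103 (1981), §2, Thm. 5.3 [JacquetShalikaAJM1981].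
-/

noncomputable section

open scoped Topology NumberField
open Filter Set Complex IsDedekindDomain
open Literature.NumberTheory.Automorphic

namespace Literature.NumberTheory.LFunctions

section Holomorphy

variable {K : Type} [Field K] [NumberField K] {N : ℕ}

/-- The twisted local factor `s ↦ ∏_{y ∈ M} (1 - y u q^{-s})⁻¹` is holomorphic on the half-plane
`{re s > c}` as soon as `‖y‖ < q^c` for all `y ∈ M` (`‖u‖ ≤ 1`, `q ≥ 1`): no factor vanishes
there. [folklore] -/
theorem differentiableOn_satakeTwistFactor (M : Multiset ℂ) {u : ℂ} (hu : ‖u‖ ≤ 1) {q : ℕ}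
    (hq : 0 < q) {c : ℝ} (hM : ∀ y ∈ M, ‖y‖ < (q : ℝ) ^ c) :
    DifferentiableOn ℂ (satakeTwistFactor M u q) {s : ℂ | c < s.re} := by
  have hq1 : (1 : ℝ) ≤ q := Nat.one_le_cast.mpr hq
  induction M using Multiset.induction_on with
  | empty =>
    have h0 : satakeTwistFactor 0 u q = fun _ => 1 := funext fun s => satakeTwistFactor_zero u q s
    rw [h0]
    exact differentiableOn_const 1
  | cons y M ih =>
    have hM' : ∀ y' ∈ M, ‖y'‖ < (q : ℝ) ^ c := fun y' hy' => hM y' (Multiset.mem_cons_of_mem hy')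
    have hy : ‖y‖ < (q : ℝ) ^ c := hM y (Multiset.mem_cons_self y M)
    have hterm : DifferentiableOn ℂ (fun s : ℂ => 1 - y * u * (q : ℂ) ^ (-s)) {s : ℂ | c < s.re} :=
      (differentiableOn_const _).sub ((differentiableOn_const _).mul
        (differentiableOn_id.neg.const_cpow (Or.inl (Nat.cast_ne_zero.mpr hq.ne'))))
    have hne : ∀ s ∈ {s : ℂ | c < s.re}, 1 - y * u * (q : ℂ) ^ (-s) ≠ 0 := by
      intro s hs h0
      have hlt : ‖y‖ < (q : ℝ) ^ s.re :=
        hy.trans_le (Real.rpow_le_rpow_of_exponent_le hq1 (le_of_lt hs))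
      have := norm_mul_mul_cpow_neg_lt_one hu hq hlt
      rw [sub_eq_zero] at h0
      rw [← h0, norm_one] at this
      exact lt_irrefl _ this
    have hcons : (satakeTwistFactor (y ::ₘ M) u q) =
        fun s => (1 - y * u * (q : ℂ) ^ (-s))⁻¹ * satakeTwistFactor M u q s := by
      funext s; exact satakeTwistFactor_cons y M u q s
    rw [hcons]
    exact (hterm.inv hne).mul (ih hM')

namespace EulerAbsConvergent

variable {L : SatakeFamily K} {c : ℝ}

/-- **The Euler product is holomorphic on any open half-plane of absolute convergence**: if
`EulerAbsConvergent L s` for all `re s > c`, then `s ↦ twistedSatakeEulerValue L χ s` is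
holomorphic on `{re s > c}` — on each `{re s > c'}`, `c' > c`, the factors are holomorphic and
within `4 ∑_{y ∈ L v} ‖y‖ q_v^{-c'}` (summable, eventually in `v`) of `1`, so the product converges
locally uniformly (Mathlib `Summable.hasProdLocallyUniformlyOn_one_add`) and locally uniform
limits of holomorphic functions are holomorphic (`TendstoLocallyUniformlyOn.differentiableOn`)
(Ahlfors, *Complex Analysis*, Ch. 5 §2.2 and Ch. 5 §1.1, Weierstrass's theorem). [folklore] -/
theorem differentiableOn_twistedSatakeEulerValue (h : ∀ s : ℂ, c < s.re → EulerAbsConvergent L s)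
    (χ : DirichletCharacter ℂ N) :
    DifferentiableOn ℂ (twistedSatakeEulerValue L χ) {s : ℂ | c < s.re} := by
  suffices H : ∀ c' : ℝ, c < c' →
      DifferentiableOn ℂ (twistedSatakeEulerValue L χ) {s : ℂ | c' < s.re} by
    intro s hs
    obtain ⟨c', hcc', hc's⟩ := exists_between (show c < s.re from hs)
    exact ((H c' hcc').differentiableAt
      ((isOpen_lt continuous_const continuous_re).mem_nhds hc's)).differentiableWithinAt
  intro c' hc'
  have hU : IsOpen {s : ℂ | c' < s.re} := isOpen_lt continuous_const continuous_re
  have hpt : EulerAbsConvergent L (c' : ℂ) := h _ (by simpa using hc')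
  have hq : ∀ v : HeightOneSpectrum (𝓞 K), 0 < v.residueCard := fun v =>
    zero_lt_one.trans v.one_lt_residueCard
  have hq1 : ∀ v : HeightOneSpectrum (𝓞 K), (1 : ℝ) ≤ v.residueCard := fun v =>
    Nat.one_le_cast.mpr (hq v)
  -- the deviations of the factors from `1`, and their uniform summable bound on `{re s > c'}`
  set t : HeightOneSpectrum (𝓞 K) → ℝ := fun v =>
    ((L v).map fun y => ‖y‖ * (v.residueCard : ℝ) ^ (-c')).sum with ht
  have ht' : Summable t := by simpa [ht] using hpt.2
  have ht0 : ∀ v, ∀ x ∈ (L v).map fun y => ‖y‖ * (v.residueCard : ℝ) ^ (-c'), 0 ≤ x := by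
    intro v x hx
    obtain ⟨y, -, rfl⟩ := Multiset.mem_map.mp hx
    positivity
  set f : HeightOneSpectrum (𝓞 K) → ℂ → ℂ := fun v s =>
    satakeTwistFactor (L v) (χ (v.residueCard : ZMod N)) v.residueCard s - 1 with hf
  have hbound : ∀ᶠ v in cofinite, ∀ s ∈ {s : ℂ | c' < s.re}, ‖f v s‖ ≤ 4 * t v := by
    filter_upwards [ht'.tendsto_cofinite_zero.eventually_le_const one_half_pos] with v hv s hs
    set u : ℂ := χ (v.residueCard : ZMod N) with hu
    have hu1 : ‖u‖ ≤ 1 := χ.norm_le_one _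
    have hz : ∀ y ∈ L v, ‖y * u * (v.residueCard : ℂ) ^ (-s)‖ ≤
        ‖y‖ * (v.residueCard : ℝ) ^ (-c') := fun y _ =>
      (norm_mul_mul_cpow_neg_le hu1 (hq v) s).trans (mul_le_mul_of_nonneg_left
        (Real.rpow_le_rpow_of_exponent_le (hq1 v) (by linarith [le_of_lt hs])) (norm_nonneg y))
    have hzt : ∀ y ∈ L v, ‖y‖ * (v.residueCard : ℝ) ^ (-c') ≤ t v := fun y hy =>
      Multiset.single_le_sum (ht0 v) _ (Multiset.mem_map.mpr ⟨y, hy, rfl⟩)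
    set g : ℂ → ℂ := fun y => (1 - y * u * (v.residueCard : ℂ) ^ (-s))⁻¹ - 1 with hg
    have hfac : satakeTwistFactor (L v) u v.residueCard s = ((L v).map fun y => 1 + g y).prod := by
      simp only [satakeTwistFactor, hg, add_sub_cancel]
    have hgle : ∀ y ∈ L v, ‖g y‖ ≤ 2 * (‖y‖ * (v.residueCard : ℝ) ^ (-c')) := fun y hy =>
      (PartialEuler.norm_inv_one_sub_sub_one_le (((hz y hy).trans (hzt y hy)).trans hv)).trans
        (by linarith [hz y hy])
    have hsum : ((L v).map fun y => ‖g y‖).sum ≤ 2 * t v := by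
      calc ((L v).map fun y => ‖g y‖).sum
          ≤ ((L v).map fun y => 2 * (‖y‖ * (v.residueCard : ℝ) ^ (-c'))).sum :=
            Multiset.sum_map_le_sum_map _ _ hgle
        _ = 2 * t v := by rw [Multiset.sum_map_mul_left]
    have htv0 : 0 ≤ t v := Multiset.sum_nonneg (ht0 v)
    calc ‖f v s‖ = ‖satakeTwistFactor (L v) u v.residueCard s - 1‖ := rfl
      _ ≤ Real.exp (((L v).map fun y => ‖g y‖).sum) - 1 := by
          rw [hfac]; exact norm_multisetProd_map_one_add_sub_one_le _ _
      _ ≤ Real.exp (2 * t v) - 1 := by gcongr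
      _ ≤ 2 * |2 * t v| := by
          have := Real.abs_exp_sub_one_le (x := 2 * t v)
            (by rw [abs_of_nonneg (by linarith)]; linarith)
          exact (le_abs_self _).trans this
      _ = 4 * t v := by rw [abs_of_nonneg (by linarith)]; ring
  -- the factors are holomorphic on `{re s > c'}`
  have hF : ∀ v, DifferentiableOn ℂ (fun s => satakeTwistFactor (L v) (χ (v.residueCard : ZMod N))
      v.residueCard s) {s : ℂ | c' < s.re} := fun v =>
    differentiableOn_satakeTwistFactor (L v) (χ.norm_le_one _) (hq v)
      (fun y hy => by simpa using hpt.1 v y hy)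
  have hcts : ∀ v, ContinuousOn (f v) {s : ℂ | c' < s.re} := fun v =>
    ((hF v).sub (differentiableOn_const 1)).continuousOn
  have hprod := Summable.hasProdLocallyUniformlyOn_one_add hU (ht'.mul_left 4) hbound hcts
  have hdiff : DifferentiableOn ℂ (fun s => ∏' v, (1 + f v s)) {s : ℂ | c' < s.re} := by
    refine (hasProdLocallyUniformlyOn_iff_tendstoLocallyUniformlyOn.mp hprod).differentiableOn
      (Eventually.of_forall fun T => ?_) hU
    exact DifferentiableOn.fun_finsetProd fun v _ => by
      simpa only [hf, add_sub_cancel] using hF v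
  refine hdiff.congr fun s hs => ?_
  rw [(h s (hc'.trans hs)).twistedSatakeEulerValue_eq_tprod χ]
  simp only [hf, add_sub_cancel]

/-- Hence the Euler product itself, on the open half-plane `{re s > c}` of absolute convergence, is
a continuation in the sense of `IsTwistedEulerContinuation` (nothing removed). [folklore] -/
theorem isTwistedEulerContinuation (h : ∀ s : ℂ, c < s.re → EulerAbsConvergent L s)
    (χ : DirichletCharacter ℂ N) :
    IsTwistedEulerContinuation L χ c {s : ℂ | c < s.re} (twistedSatakeEulerValue L χ) :=
  IsTwistedEulerContinuation.of_differentiableOn le_rfl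
    (differentiableOn_twistedSatakeEulerValue h χ) fun s hs => ⟨h s hs, rfl⟩

/-- **Continued value = value on open half-planes of absolute convergence**: for `re s₀ > c` with
the Euler product absolutely convergent on `{re s > c}`,
`twistedSatakeContinuedValue L χ s₀ = twistedSatakeEulerValue L χ s₀` (so the continued value
extends, and never contradicts, the convergent Euler product). [folklore] -/
theorem twistedSatakeContinuedValue_eq (h : ∀ s : ℂ, c < s.re → EulerAbsConvergent L s)
    (χ : DirichletCharacter ℂ N) {s₀ : ℂ} (hs₀ : c < s₀.re) :
    twistedSatakeContinuedValue L χ s₀ = twistedSatakeEulerValue L χ s₀ :=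
  (isTwistedEulerContinuation h χ).continuedValue_eq hs₀

/-- The Rankin–Selberg case of the previous statement. [folklore] -/
theorem twistedRankinSelbergContinuedValue_eq {α β : SatakeFamily K}
    (h : ∀ s : ℂ, c < s.re → EulerAbsConvergent (fun v => satakeTensor (α v) (β v)) s)
    (χ : DirichletCharacter ℂ N) {s₀ : ℂ} (hs₀ : c < s₀.re) :
    twistedRankinSelbergContinuedValue α β χ s₀ = twistedRankinSelbergEulerValue α β χ s₀ :=
  twistedSatakeContinuedValue_eq h χ hs₀

end EulerAbsConvergent

end Holomorphy

end Literature.NumberTheory.LFunctions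

end
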